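import Summits.Ventures.YMGap.FlowData.RitzDeflationCertificate

/-!
# Venture YMGap, track Y3 FLOW-DATA — TAIL-A at operator level: the KEPT-DATA HYPOTHESES from an isotypic
# decomposition WITHOUT completeness (Bessel's inequality suffices)

HONEST FRAMING: venture file of the cell `pub-ymgap` (QuantumFields programme), track Y3, lineage A (seat flow-eng-1).
Abstract real inner-product-space algebra; NO lattice object, no number, no row, nothing about limits or a mass gap.

WHY.  `KWeightTailOperator` (files 1–4) bounds the typed sector tops `‖T ∘ P_e‖` by the kept Galerkin block under three
KEPT-DATA hypotheses on the kinetic operator `𝒦`: (h1) the kept family `f_i` is orthonormal with `𝒦 f_i = q_i f_i`;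
(h2) DROPPED BOUND `⟪z, 𝒦 z⟫ ≤ κ‖z‖²` for every `z` orthogonal to all `f_i`; (h3) `𝒦 ⪰ 0`.  For the tube, `𝒦` is
known through an ISOTYPIC DECOMPOSITION: a family of symmetric idempotents `p_ν` (the character projections `p_ν` of
`LinkCharacterMerging` / `LinkCharacterBessel`, one per multi-index of link representations), mutually orthogonal, with
BESSEL's inequality `Σ_{ν ∈ S} ‖p_ν z‖² ≤ ‖z‖²` for finite `S` (`sum_integral_charProj_sq_le` — no Peter–Weyl / no
completeness), and the kinetic form as the series `⟪z, 𝒦 z⟫ = Σ_ν q_ν ‖p_ν z‖²` with `q_ν ≥ 0` (the link-weight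
character series of `LinkWeightExpansion`).  This file derives (h1)–(h3) from such data, abstractly:

* `inner_idem_self` — for a symmetric idempotent `p`: `⟪z, p z⟫ = ‖p z‖²`; `apply_eq_zero_of_orthogonal_range` — if
  `z ⊥ p y` for all `y` then `p z = 0`;
* **`dropped_bound_of_hasSum`** — if `⟪z, 𝒦 z⟫ = Σ_ν q_ν ‖p_ν z‖²` (as a `HasSum`), `q_ν ≤ κ` (`κ ≥ 0`) off a finite
  kept set `K` of indices, Bessel holds, and `p_ν z = 0` for every `ν ∈ K`, then `⟪z, 𝒦 z⟫ ≤ κ‖z‖²`;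
* **`dropped_bound_of_span`** — (h2): if moreover the kept family `f_i` is such that every `p_ν y`, `ν ∈ K`, lies in
  the span of the `f_i` (the kept family EXHAUSTS the kept isotypic components), then `z ⊥ f_i ∀ i ⇒ ⟪z, 𝒦 z⟫ ≤ κ‖z‖²`;
* `inner_kinetic_nonneg_of_hasSum` — (h3) as a form statement: `0 ≤ ⟪z, 𝒦 z⟫`;
* `kinetic_apply_of_mem_range` — (h1): if `𝒦 (p_ν y) = q_ν • p_ν y` for all `y` and `f = p_ν y` then `𝒦 f = q_ν • f`.

WHAT IS NOT HERE: the tube instance (that the character projections and the link-weight series of the tree satisfy these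
hypotheses for the Gauss-law kinetic operator of `tubeTransferOperator`, and that the engine's spin networks exhaust the
gauge-invariant part of the kept isotypic components — the intertwiner count); numbers.

References: R. A. Horn, C. R. Johnson, *Matrix Analysis*, 2nd ed. (2013) §7.7 [cite: HornJohnson2013, §7.7]; Bessel's
inequality [folklore]; the cell's FLOW-REFEREE.md FR-18 and HOME/pub-ymgap-flow-eng-1/ENGINE.md §18.3.
-/

noncomputable section

open scoped InnerProductSpace BigOperators
open Finset

namespace Summit.Ventures.YMGap.FlowData

namespace KWeightTailOperator

section Isotypic

variable {F : Type*} [NormedAddCommGroup F] [InnerProductSpace ℝ F] {N : Type*}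
  {p : N → F →L[ℝ] F} {𝒦 : F →L[ℝ] F} {q : N → ℝ}

omit N in
/-- For a symmetric idempotent `p`: `⟪z, p z⟫ = ‖p z‖²`. [folklore] -/
theorem inner_idem_self {P : F →L[ℝ] F} (hsym : (P : F →ₗ[ℝ] F).IsSymmetric) (hidem : ∀ x, P (P x) = P x)
    (z : F) : ⟪z, P z⟫_ℝ = ‖P z‖ ^ 2 := by
  have h := hsym (P z) z
  simp only [ContinuousLinearMap.coe_coe] at h
  rw [← real_inner_self_eq_norm_sq, ← h, hidem, real_inner_comm]

omit N in
/-- A vector orthogonal to the range of a symmetric idempotent is killed by it. [folklore] -/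
theorem apply_eq_zero_of_orthogonal_range {P : F →L[ℝ] F} (hsym : (P : F →ₗ[ℝ] F).IsSymmetric)
    (hidem : ∀ x, P (P x) = P x) {z : F} (hz : ∀ y, ⟪P y, z⟫_ℝ = 0) : P z = 0 := by
  have h : ‖P z‖ ^ 2 = 0 := by rw [← inner_idem_self hsym hidem z, real_inner_comm, hz z]
  exact norm_eq_zero.mp (pow_eq_zero_iff (two_ne_zero) |>.mp h)

/-- **The dropped bound from an isotypic series and Bessel's inequality.**  If the kinetic form is the series
`⟪z, 𝒦 z⟫ = Σ_ν q_ν ‖p_ν z‖²`, the weights off the finite kept index set `K` are `≤ κ` (`κ ≥ 0`), the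
partial sums `Σ_{ν ∈ S} ‖p_ν z‖²` are `≤ ‖z‖²` (Bessel), and `p_ν z = 0` for `ν ∈ K`, then `⟪z, 𝒦 z⟫ ≤ κ‖z‖²`. [folklore] -/
theorem dropped_bound_of_hasSum {z : F} (hform : HasSum (fun ν => q ν * ‖p ν z‖ ^ 2) ⟪z, 𝒦 z⟫_ℝ)
    (K : Finset N) {κ : ℝ} (hκ0 : 0 ≤ κ) (hκ : ∀ ν, ν ∉ K → q ν ≤ κ)
    (hBessel : ∀ S : Finset N, ∑ ν ∈ S, ‖p ν z‖ ^ 2 ≤ ‖z‖ ^ 2) (hz : ∀ ν ∈ K, p ν z = 0) :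
    ⟪z, 𝒦 z⟫_ℝ ≤ κ * ‖z‖ ^ 2 := by
  -- every partial sum of the series is `≤ κ‖z‖²`
  refine hasSum_le_of_sum_le hform fun S => ?_
  calc ∑ ν ∈ S, q ν * ‖p ν z‖ ^ 2 ≤ ∑ ν ∈ S, κ * ‖p ν z‖ ^ 2 := by
        refine Finset.sum_le_sum fun ν _ => ?_
        by_cases hν : ν ∈ K
        · rw [hz ν hν, norm_zero]; simp
        · exact mul_le_mul_of_nonneg_right (hκ ν hν) (sq_nonneg _)
    _ = κ * ∑ ν ∈ S, ‖p ν z‖ ^ 2 := by rw [Finset.mul_sum]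
    _ ≤ κ * ‖z‖ ^ 2 := mul_le_mul_of_nonneg_left (hBessel S) hκ0

/-- **Hypothesis (h2) of `KWeightTailOperator`** from an isotypic decomposition: with the series, the weights, Bessel,
symmetric idempotents `p_ν`, and a kept family `f_i` whose span contains `p_ν y` for every kept `ν` and every `y`
(the kept family EXHAUSTS the kept components), every `z` orthogonal to all `f_i` has `⟪z, 𝒦 z⟫ ≤ κ‖z‖²`. [folklore] -/
theorem dropped_bound_of_span {ι : Type*} {f : ι → F}
    (hform : ∀ z, HasSum (fun ν => q ν * ‖p ν z‖ ^ 2) ⟪z, 𝒦 z⟫_ℝ)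
    (K : Finset N) {κ : ℝ} (hκ0 : 0 ≤ κ) (hκ : ∀ ν, ν ∉ K → q ν ≤ κ)
    (hBessel : ∀ z, ∀ S : Finset N, ∑ ν ∈ S, ‖p ν z‖ ^ 2 ≤ ‖z‖ ^ 2)
    (hsym : ∀ ν ∈ K, (p ν : F →ₗ[ℝ] F).IsSymmetric) (hidem : ∀ ν ∈ K, ∀ x, p ν (p ν x) = p ν x)
    (hspan : ∀ ν ∈ K, ∀ y, p ν y ∈ Submodule.span ℝ (Set.range f))
    (z : F) (hz : ∀ i, ⟪f i, z⟫_ℝ = 0) : ⟪z, 𝒦 z⟫_ℝ ≤ κ * ‖z‖ ^ 2 := by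
  refine dropped_bound_of_hasSum (hform z) K hκ0 hκ (hBessel z) fun ν hν => ?_
  refine apply_eq_zero_of_orthogonal_range (hsym ν hν) (hidem ν hν) fun y => ?_
  -- `p_ν y ∈ span f` and `z ⊥ f_i` for all `i`
  have hmem := hspan ν hν y
  refine Submodule.span_induction (p := fun w _ => ⟪w, z⟫_ℝ = 0) ?_ ?_ ?_ ?_ hmem
  · rintro _ ⟨i, rfl⟩; exact hz i
  · exact inner_zero_left _
  · intro a b _ _ ha hb; rw [inner_add_left, ha, hb, add_zero]
  · intro r a _ ha; rw [real_inner_smul_left, ha, mul_zero]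

/-- **Hypothesis (h3)** as a form statement: the kinetic form is non-negative. [folklore] -/
theorem inner_kinetic_nonneg_of_hasSum {z : F} (hform : HasSum (fun ν => q ν * ‖p ν z‖ ^ 2) ⟪z, 𝒦 z⟫_ℝ)
    (hq0 : ∀ ν, 0 ≤ q ν) : 0 ≤ ⟪z, 𝒦 z⟫_ℝ :=
  hform.nonneg fun ν => mul_nonneg (hq0 ν) (sq_nonneg _)

/-- `𝒦 ⪰ 0` as Mathlib's `ContinuousLinearMap.IsPositive`, from the series and the symmetry of `𝒦`. [folklore] -/
theorem isPositive_of_hasSum (h𝒦 : (𝒦 : F →ₗ[ℝ] F).IsSymmetric)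
    (hform : ∀ z, HasSum (fun ν => q ν * ‖p ν z‖ ^ 2) ⟪z, 𝒦 z⟫_ℝ) (hq0 : ∀ ν, 0 ≤ q ν) : 𝒦.IsPositive := by
  refine ContinuousLinearMap.isPositive_def.mpr ⟨h𝒦, fun z => ?_⟩
  rw [ContinuousLinearMap.reApplyInnerSelf_apply, RCLike.re_to_real, real_inner_comm]
  exact inner_kinetic_nonneg_of_hasSum (hform z) hq0

omit q in
/-- **Hypothesis (h1)**: a kept vector inside the component `ν` is an eigenvector with the component's weight. [folklore] -/
theorem kinetic_apply_of_mem_range {ν : N} {qν : ℝ} (heig : ∀ y, 𝒦 (p ν y) = qν • p ν y) {f : F} {y : F}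
    (hf : f = p ν y) : 𝒦 f = qν • f := by
  rw [hf, heig]

end Isotypic

end KWeightTailOperator

end Summit.Ventures.YMGap.FlowData
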